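import Summits.Ventures.Crystal3D.Theorems.StickyWulffConstantCoaxialWallLawSkewArithmetic
import HarnessLib

/-!
# FOUR LATTICE CONTACTS FORCE A LATTICE POINT, I: the kernel table (crux `CoaxialWallLaw`, stmt-Ventures-19481, line `WallLedgerF`;
# rigidity lemma of the line of `stub_multiGrainSmallHigh`)

HONEST FRAMING. Venture `Summits/Ventures/Crystal3D` (cell `crystal3d-full`), helper `--supports` the crux `CoaxialWallLaw` of
`route-Ventures-StickyWulffConstant` (REGISTERED line `WallLedgerF`, skeleton 'CoaxialWallLawCertificates' v4, stub `stub_multiGrainSmallHigh :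
KissingGap (5/2) → KissingClassification (5/2) → TailResidue.MultiGrainSmallHigh (2√6) 3`).  Rung credit only; F-C1 not moved; census-free.
cf-p1 (clxxxii): «the locking lemma and the tetravacancy rigidity fact land as LEMMAS of T5b's line».  The locking lemma is `…KissingCage`
(`eq_slot_of_kissing_cage`); `…ForeignContacts.foreign_contact_frame_contacts_le_two` bounds the contacts of an off-frame ball inside ONE host star.
This file and its two sequels (`…LatticeContactsBridge`, `…LatticeContacts`) prove the GLOBAL form (memo HOME/wall-19481-p2/F-TAIL-g10.md §10 (C1),
calc/t5/c1_checker.py): **a point at distance `1` from four distinct points of an fcc lattice (nearest-neighbour distance `1`) is itself a lattice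
point** — dust jammed against a crystallite, off its lattice, touches at most THREE of its balls.
In integer cubic coordinates (`√2 · cubicCoords`; lattice `D₃ = {z ∈ ℤ³ : Σ z even}`; unit distance ↔ `|Δ|² = 2`), translating one contact to `0`, the
other three are distinct nonzero `D₃`-vectors `a, b, c` of norm² `≤ 8` (the `54`-element table `T54`) with `2 u·a = |a|²` etc. for the point `u`,
`|u|² = 2`, and the claim is `u ∈ S12` (the twelve slots).  THIS FILE: the integer kernel and its `decide`d tables —
* `check a b c` — pairwise-distance pruning (common contacts are `≤ 2√2` apart); full rank ⇒ Cramer numerator `W` (`2d·u = W`) with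
  `|W|² = 8d² ⇒ W ∈ 2d·S12` (`fullCheck`); rank two ⇒ Gram elimination (`gramDet • t = α p + β q`, consistency of the third equation, and the
  `≤ 2` real solutions `2G·v = P₀ ± s (p×q)`, `s²G = N`, are slots: `rank2Check`, `sols`); the all-collinear case does not survive pruning;
* **`table`** — `check a b c = true` for `a` in sign normal form (`reps12`) and `b, c ∈ T54` (twelve `decide`s of `54²` cases);
* `exists_flip_mem_reps12`, `flip_mem_T54`, `flip_mem_S12`, `signs8_sq`, `S12_norm`, `mem_T54` — bookkeeping of the sign normal form and the table.
WHAT THIS IS NOT: no real geometry (that is `…LatticeContactsBridge` / `…LatticeContacts`); not the stub; F-C1 not moved.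
-/

noncomputable section

namespace Summit.Ventures.Crystal3D.Theorems

namespace LatticeContacts

open Summit.Ventures.Crystal3D Finset
open Literature.MathematicalPhysics.StatisticalMechanics (fccStacking)
open scoped InnerProductSpace

/-! ### §1 The integer kernel -/

/-- Integer triples (cubic coordinates scaled by `√2`). -/
abbrev V3 := ℤ × ℤ × ℤ

/-- dot product -/
def dotZ (p q : V3) : ℤ := p.1 * q.1 + p.2.1 * q.2.1 + p.2.2 * q.2.2
/-- cross product -/
def crossZ (p q : V3) : V3 := (p.2.1 * q.2.2 - p.2.2 * q.2.1, p.2.2 * q.1 - p.1 * q.2.2, p.1 * q.2.1 - p.2.1 * q.1)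
/-- sum -/
def addZ (p q : V3) : V3 := (p.1 + q.1, p.2.1 + q.2.1, p.2.2 + q.2.2)
/-- difference -/
def subZ (p q : V3) : V3 := (p.1 - q.1, p.2.1 - q.2.1, p.2.2 - q.2.2)
/-- integer multiple -/
def smulZ (c : ℤ) (p : V3) : V3 := (c * p.1, c * p.2.1, c * p.2.2)
/-- componentwise sign flip -/
def flipZ (e p : V3) : V3 := (e.1 * p.1, e.2.1 * p.2.1, e.2.2 * p.2.2)

/-- The twelve slots (`D₃`-vectors of norm² `2`). -/
def S12 : List V3 :=
  [(1, 1, 0), (1, -1, 0), (-1, 1, 0), (-1, -1, 0), (1, 0, 1), (1, 0, -1), (-1, 0, 1), (-1, 0, -1),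
   (0, 1, 1), (0, 1, -1), (0, -1, 1), (0, -1, -1)]

/-- The `54` nonzero `D₃`-vectors of norm² `≤ 8`. -/
def T54 : List V3 :=
  S12 ++ [(2, 0, 0), (-2, 0, 0), (0, 2, 0), (0, -2, 0), (0, 0, 2), (0, 0, -2)] ++
  [(2, 1, 1), (2, 1, -1), (2, -1, 1), (2, -1, -1), (-2, 1, 1), (-2, 1, -1), (-2, -1, 1), (-2, -1, -1),
   (1, 2, 1), (1, 2, -1), (-1, 2, 1), (-1, 2, -1), (1, -2, 1), (1, -2, -1), (-1, -2, 1), (-1, -2, -1),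
   (1, 1, 2), (1, -1, 2), (-1, 1, 2), (-1, -1, 2), (1, 1, -2), (1, -1, -2), (-1, 1, -2), (-1, -1, -2)] ++
  [(2, 2, 0), (2, -2, 0), (-2, 2, 0), (-2, -2, 0), (2, 0, 2), (2, 0, -2), (-2, 0, 2), (-2, 0, -2),
   (0, 2, 2), (0, 2, -2), (0, -2, 2), (0, -2, -2)]

/-- Sign normal forms (all coordinates `≥ 0`). -/
def reps12 : List V3 :=
  [(1, 1, 0), (1, 0, 1), (0, 1, 1), (2, 0, 0), (0, 2, 0), (0, 0, 2), (2, 1, 1), (1, 2, 1), (1, 1, 2), (2, 2, 0), (2, 0, 2), (0, 2, 2)]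

/-- The eight sign vectors. -/
def signs8 : List V3 :=
  [(1, 1, 1), (1, 1, -1), (1, -1, 1), (1, -1, -1), (-1, 1, 1), (-1, 1, -1), (-1, -1, 1), (-1, -1, -1)]

/-- Does the slot `σ` solve `2 σ·v = |v|²` for `v = p, q, t`? -/
def solves (p q t σ : V3) : Bool :=
  (2 * dotZ σ p == dotZ p p) && (2 * dotZ σ q == dotZ q q) && (2 * dotZ σ t == dotZ t t)

/-- The slots solving the three equations. -/
def sols (p q t : V3) : List V3 := S12.filter fun σ => solves p q t σ

/-- Cramer numerator: `W = (q×t)|p|² + (t×p)|q|² + (p×q)|t|²` (`2d·u = W`). -/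
def cramerW (p q t : V3) : V3 :=
  addZ (addZ (smulZ (dotZ p p) (crossZ q t)) (smulZ (dotZ q q) (crossZ t p))) (smulZ (dotZ t t) (crossZ p q))

/-- Full-rank branch: `|W|² = 8d²` forces `W ∈ 2d·S12`. -/
def fullCheck (p q t : V3) (d : ℤ) : Bool :=
  (dotZ (cramerW p q t) (cramerW p q t) != 8 * d * d) || (S12.any fun σ => smulZ (2 * d) σ == cramerW p q t)

/-- Gram determinant of the pair. -/
def gramDet (p q : V3) : ℤ := dotZ p p * dotZ q q - dotZ p q * dotZ p q
/-- coefficient of `p` in `gramDet • t` -/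
def alphaZ (p q t : V3) : ℤ := dotZ t p * dotZ q q - dotZ t q * dotZ p q
/-- coefficient of `q` in `gramDet • t` -/
def betaZ (p q t : V3) : ℤ := dotZ p p * dotZ t q - dotZ p q * dotZ t p
/-- `P₀ = 2 gramDet • p₀`, `p₀` the in-plane solution of `2 p·v = |p|², 2 q·v = |q|²`. -/
def P0 (p q : V3) : V3 :=
  addZ (smulZ (dotZ p p * dotZ q q - dotZ q q * dotZ p q) p) (smulZ (dotZ p p * dotZ q q - dotZ p q * dotZ p p) q)
/-- `N = 8G² − |P₀|²` (`s²G = N` for every real solution `2G v = P₀ + s (p×q)`). -/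
def NZ (p q : V3) : ℤ := 8 * gramDet p q * gramDet p q - dotZ (P0 p q) (P0 p q)

/-- Rank-two branch with independent pair `(p, q)` and third vector `t`. -/
def rank2Check (p q t : V3) : Bool :=
  if smulZ (gramDet p q) t ≠ addZ (smulZ (alphaZ p q t) p) (smulZ (betaZ p q t) q) then false
  else if gramDet p q * dotZ t t ≠ alphaZ p q t * dotZ p p + betaZ p q t * dotZ q q then true
  else if NZ p q < 0 then true
  else if NZ p q = 0 then decide (1 ≤ (sols p q t).length)
  else decide ((sols p q t).length = 2)

/-- The kernel check of a contact triple. -/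
def check (a b c : V3) : Bool :=
  if 8 < dotZ (subZ a b) (subZ a b) ∨ 8 < dotZ (subZ a c) (subZ a c) ∨ 8 < dotZ (subZ b c) (subZ b c) then true
  else if a = b ∨ a = c ∨ b = c then true
  else if dotZ a (crossZ b c) ≠ 0 then fullCheck a b c (dotZ a (crossZ b c))
  else if crossZ a b ≠ (0, 0, 0) then rank2Check a b c
  else if crossZ a c ≠ (0, 0, 0) then rank2Check a c b
  else false

set_option maxRecDepth 8192 in
/-- Kernel table, first vector `(1, 1, 0)`. -/
theorem table0 : ∀ b ∈ T54, ∀ c ∈ T54, check (1, 1, 0) b c = true := by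
  decide

set_option maxRecDepth 8192 in
/-- Kernel table, first vector `(1, 0, 1)`. -/
theorem table1 : ∀ b ∈ T54, ∀ c ∈ T54, check (1, 0, 1) b c = true := by
  decide

set_option maxRecDepth 8192 in
/-- Kernel table, first vector `(0, 1, 1)`. -/
theorem table2 : ∀ b ∈ T54, ∀ c ∈ T54, check (0, 1, 1) b c = true := by
  decide

set_option maxRecDepth 8192 in
/-- Kernel table, first vector `(2, 0, 0)`. -/
theorem table3 : ∀ b ∈ T54, ∀ c ∈ T54, check (2, 0, 0) b c = true := by
  decide

set_option maxRecDepth 8192 in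
/-- Kernel table, first vector `(0, 2, 0)`. -/
theorem table4 : ∀ b ∈ T54, ∀ c ∈ T54, check (0, 2, 0) b c = true := by
  decide

set_option maxRecDepth 8192 in
/-- Kernel table, first vector `(0, 0, 2)`. -/
theorem table5 : ∀ b ∈ T54, ∀ c ∈ T54, check (0, 0, 2) b c = true := by
  decide

set_option maxRecDepth 8192 in
/-- Kernel table, first vector `(2, 1, 1)`. -/
theorem table6 : ∀ b ∈ T54, ∀ c ∈ T54, check (2, 1, 1) b c = true := by
  decide

set_option maxRecDepth 8192 in
/-- Kernel table, first vector `(1, 2, 1)`. -/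
theorem table7 : ∀ b ∈ T54, ∀ c ∈ T54, check (1, 2, 1) b c = true := by
  decide

set_option maxRecDepth 8192 in
/-- Kernel table, first vector `(1, 1, 2)`. -/
theorem table8 : ∀ b ∈ T54, ∀ c ∈ T54, check (1, 1, 2) b c = true := by
  decide

set_option maxRecDepth 8192 in
/-- Kernel table, first vector `(2, 2, 0)`. -/
theorem table9 : ∀ b ∈ T54, ∀ c ∈ T54, check (2, 2, 0) b c = true := by
  decide

set_option maxRecDepth 8192 in
/-- Kernel table, first vector `(2, 0, 2)`. -/
theorem table10 : ∀ b ∈ T54, ∀ c ∈ T54, check (2, 0, 2) b c = true := by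
  decide

set_option maxRecDepth 8192 in
/-- Kernel table, first vector `(0, 2, 2)`. -/
theorem table11 : ∀ b ∈ T54, ∀ c ∈ T54, check (0, 2, 2) b c = true := by
  decide

/-- **THE KERNEL TABLE** (sign normal form of the first vector). -/
theorem table : ∀ a ∈ reps12, ∀ b ∈ T54, ∀ c ∈ T54, check a b c = true := by
  intro a ha
  simp only [reps12, List.mem_cons, List.not_mem_nil, or_false] at ha
  rcases ha with rfl | rfl | rfl | rfl | rfl | rfl | rfl | rfl | rfl | rfl | rfl | rfl
  exacts [table0, table1, table2, table3, table4, table5, table6, table7, table8, table9, table10, table11]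

/-- Every table vector has a sign flip in normal form. -/
theorem exists_flip_mem_reps12 : ∀ a ∈ T54, ∃ e ∈ signs8, flipZ e a ∈ reps12 := by
  decide

/-- The table is closed under sign flips. -/
theorem flip_mem_T54 : ∀ e ∈ signs8, ∀ a ∈ T54, flipZ e a ∈ T54 := by
  decide

/-- The slots are closed under sign flips. -/
theorem flip_mem_S12 : ∀ e ∈ signs8, ∀ σ ∈ S12, flipZ e σ ∈ S12 := by
  decide

/-- Sign vectors have unit entries. -/
theorem signs8_sq : ∀ e ∈ signs8, e.1 * e.1 = 1 ∧ e.2.1 * e.2.1 = 1 ∧ e.2.2 * e.2.2 = 1 := by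
  decide

/-- Slots have norm² `2`. -/
theorem S12_norm : ∀ σ ∈ S12, dotZ σ σ = 2 := by
  decide

/-- `D₃`-vectors of norm² `≤ 8` are in the table. -/
theorem mem_T54 (a : V3) (heven : (a.1 + a.2.1 + a.2.2) % 2 = 0) (ha0 : a ≠ (0, 0, 0)) (hn : dotZ a a ≤ 8) :
    a ∈ T54 := by
  obtain ⟨x, y, z⟩ := a
  simp only [dotZ] at hn
  have hx : -2 ≤ x ∧ x ≤ 2 := by constructor <;> nlinarith [sq_nonneg y, sq_nonneg z, sq_nonneg (x + 3), sq_nonneg (x - 3)]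
  have hy : -2 ≤ y ∧ y ≤ 2 := by constructor <;> nlinarith [sq_nonneg x, sq_nonneg z, sq_nonneg (y + 3), sq_nonneg (y - 3)]
  have hz : -2 ≤ z ∧ z ≤ 2 := by constructor <;> nlinarith [sq_nonneg x, sq_nonneg y, sq_nonneg (z + 3), sq_nonneg (z - 3)]
  obtain ⟨hx1, hx2⟩ := hx; obtain ⟨hy1, hy2⟩ := hy; obtain ⟨hz1, hz2⟩ := hz
  interval_cases x <;> interval_cases y <;> interval_cases z <;> simp_all (config := { decide := true })

end LatticeContacts

end Summit.Ventures.Crystal3D.Theorems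

end
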